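import Summits.AtomisticToContinuum.Crystallization.Theorems.HolmgrenBoyleLindLineAnalytic

/-!
# Route `HolmgrenBoyleLind`: Lennard-Jones force fields of separated sources, part 2 —
the field vanishes along clear segments issuing from its open zero set

Support file for item stmt-AtomisticToContinuum-6079 (`FLCEquilibriumPeriodic` ⇔ crux
`HalfSpaceUniqueContinuation`), continuing `HolmgrenBoyleLindLineAnalytic.lean`. For two
`δ`-separated sources `X⁺, X⁻ ⊂ ℝ³` the signed force field is
`Φ(x) = Σ'_{y ∈ X⁺} (V′(|x−y|)/|x−y|)(x − y) − Σ'_{y ∈ X⁻} (V′(|x−y|)/|x−y|)(x − y)`.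

* `hbl_differentiableOn_lineSum` — along the line `s ↦ p + s v` the complexified sum
  `Σ'_y H_y(s)` over one separated source is holomorphic on the thin rectangle
  `a₁ < re s < a₂`, `|im s| < η` as soon as the real segment is `ρ`-clear of the source and
  `η‖v‖ ≤ ρ/2` (`Complex.differentiableOn_tsum_of_summable_norm` with the packing majorant);
* `hbl_lineSum_ofReal` — on the real axis it equals `⟪e, Σ'_y (V′/d)(p + σ v − y)⟫`;
* `hbl_inner_field_eq_zero_on_line` — **identity theorem along a line**: if `⟪e, Φ(p + σ v)⟫ = 0`
  for `σ` near some `t₀ ∈ (a₁, a₂)`, then for all `σ ∈ (a₁, a₂)`;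
* `hbl_field_eq_zero_of_clean_segment` — if `Φ` vanishes on an open set `U₀ ∋ x₀` and the closed
  segment `[x₀, x]` misses `X⁺ ∪ X⁻`, then `Φ(x) = 0` (clearance by compactness, then the previous
  theorem for every test vector `e`).

All `[folklore]`; nothing here closes an item.
-/

noncomputable section

namespace Summit.AtomisticToContinuum.Crystallization.Theorems

open scoped BigOperators Topology InnerProductSpace
open Filter Set
open Literature.MathematicalPhysics.StatisticalMechanics
open Summit.AtomisticToContinuum.Crystallization.Theorems.ExcessDecayLiouville
open Summit.AtomisticToContinuum.Crystallization.Theorems.HolmgrenBoyleLind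

/-! ## Holomorphy of the line sum over one separated source -/

/-- Geometry of the thin rectangle: for `a₁ < re s < a₂`, `|im s| < η`, `η‖v‖ ≤ ρ/2` and a point `y`
that is `ρ`-clear of the real segment, the real point `p − y + (re s) v` has norm `≥ ρ` and
`≥ dist y p / 2 − max |a₁| |a₂| · ‖v‖`, and `‖(im s) v‖ ≤ ρ/2`. [folklore] -/
theorem hbl_rectangle_geometry {ρ η : ℝ} (p v y : (EuclideanSpace ℝ (Fin 3))) {a₁ a₂ : ℝ}
    (hclear : ∀ σ : ℝ, a₁ ≤ σ → σ ≤ a₂ → ρ ≤ ‖p + σ • v - y‖) (hηv : η * ‖v‖ ≤ ρ / 2) {s : ℂ}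
    (hs : s ∈ Complex.re ⁻¹' Set.Ioo a₁ a₂ ∩ Complex.im ⁻¹' Set.Ioo (-η) η) :
    ρ ≤ ‖p - y + s.re • v‖ ∧
      max ρ (dist y p / 2 - max |a₁| |a₂| * ‖v‖) ≤ ‖p - y + s.re • v‖ ∧ ‖s.im • v‖ ≤ ρ / 2 := by
  obtain ⟨⟨h1, h2⟩, ⟨h3, h4⟩⟩ := hs
  have heq : p - y + s.re • v = p + s.re • v - y := by abel
  have ha : ρ ≤ ‖p - y + s.re • v‖ := by
    rw [heq]
    exact hclear s.re h1.le h2.le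
  refine ⟨ha, max_le ha ?_, ?_⟩
  · have hσ : |s.re| ≤ max |a₁| |a₂| := by
      rw [abs_le]
      constructor
      · have : -|a₁| ≤ a₁ := neg_abs_le a₁
        linarith [le_max_left |a₁| |a₂|]
      · linarith [le_abs_self a₂, le_max_right |a₁| |a₂|]
    have hpy : ‖p - y‖ = dist y p := by rw [dist_comm, dist_eq_norm]
    have htri : ‖p - y‖ ≤ ‖p - y + s.re • v‖ + ‖s.re • v‖ := by
      have := norm_sub_le (p - y + s.re • v) (s.re • v)
      rwa [add_sub_cancel_right] at this
    have hsv : ‖s.re • v‖ ≤ max |a₁| |a₂| * ‖v‖ := by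
      rw [norm_smul, Real.norm_eq_abs]
      exact mul_le_mul_of_nonneg_right hσ (norm_nonneg _)
    rw [hpy] at htri
    linarith [dist_nonneg (x := y) (y := p)]
  · rw [norm_smul, Real.norm_eq_abs]
    have him : |s.im| ≤ η := (abs_lt.2 ⟨h3, h4⟩).le
    calc |s.im| * ‖v‖ ≤ η * ‖v‖ := mul_le_mul_of_nonneg_right him (norm_nonneg _)
      _ ≤ ρ / 2 := hηv

/-- **Holomorphy of the line sum.** Over a `δ`-separated source `X`, along the line `s ↦ p + s v`,
with a test vector `e`: if the real segment `a₁ ≤ σ ≤ a₂` is `ρ`-clear of `X` and `η‖v‖ ≤ ρ/2`,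
then `s ↦ Σ'_{y ∈ X} H_y(s)` is holomorphic on the rectangle `a₁ < re s < a₂`, `|im s| < η`
(dominated by the summable packing majorant, `Complex.differentiableOn_tsum_of_summable_norm`).
[folklore] -/
theorem hbl_differentiableOn_lineSum {X : Set (EuclideanSpace ℝ (Fin 3))} {δ ρ η : ℝ} (hδ : 0 < δ) (hρ : 0 < ρ)
    (hsep : ∀ a ∈ X, ∀ b ∈ X, a ≠ b → δ ≤ dist a b) (p v e : (EuclideanSpace ℝ (Fin 3))) {a₁ a₂ : ℝ}
    (hclear : ∀ y ∈ X, ∀ σ : ℝ, a₁ ≤ σ → σ ≤ a₂ → ρ ≤ ‖p + σ • v - y‖)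
    (hηv : η * ‖v‖ ≤ ρ / 2) :
    DifferentiableOn ℂ (fun s : ℂ => ∑' y : X,
      (((((‖p - y‖ ^ 2 : ℝ) : ℂ) + 2 * s * ((⟪p - y, v⟫_ℝ : ℝ) : ℂ) + s ^ 2 * ((‖v‖ ^ 2 : ℝ) : ℂ)) ^ 4)⁻¹ -
        ((((‖p - y‖ ^ 2 : ℝ) : ℂ) + 2 * s * ((⟪p - y, v⟫_ℝ : ℝ) : ℂ) + s ^ 2 * ((‖v‖ ^ 2 : ℝ) : ℂ)) ^ 7)⁻¹) *
      (((⟪e, p - y⟫_ℝ : ℝ) : ℂ) + s * ((⟪e, v⟫_ℝ : ℝ) : ℂ)))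
      (Complex.re ⁻¹' Set.Ioo a₁ a₂ ∩ Complex.im ⁻¹' Set.Ioo (-η) η) := by
  set L : ℝ := max |a₁| |a₂| * ‖v‖ with hL
  have hU : IsOpen (Complex.re ⁻¹' Set.Ioo a₁ a₂ ∩ Complex.im ⁻¹' Set.Ioo (-η) η) :=
    (isOpen_Ioo.preimage Complex.continuous_re).inter (isOpen_Ioo.preimage Complex.continuous_im)
  refine Complex.differentiableOn_tsum_of_summable_norm
    (u := fun y : X => ‖e‖ * (32 + 256 * (ρ⁻¹) ^ 6) * ((max ρ (dist (y : (EuclideanSpace ℝ (Fin 3))) p / 2 - L))⁻¹) ^ 7)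
    (hbl_summable_inv_pow_seven L hδ hρ hsep (fun y : X => (y : (EuclideanSpace ℝ (Fin 3)))) Subtype.val_injective
      (fun y => y.2) p (by positivity)) (fun y => ?_) hU (fun y s hs => ?_)
  · intro s hs
    obtain ⟨ha, -, hb⟩ := hbl_rectangle_geometry p v (y : (EuclideanSpace ℝ (Fin 3))) (hclear y y.2) hηv hs
    refine (hbl_differentiableAt_lineH (p - y) v e ?_).differentiableWithinAt
    have hQ := hbl_norm_lineQ_ge ha hb
    have hpos : 0 < ‖p - ↑y + s.re • v‖ ^ 2 / 2 := by
      have : 0 < ‖p - ↑y + s.re • v‖ := hρ.trans_le ha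
      positivity
    exact norm_pos_iff.1 (hpos.trans_le hQ)
  · obtain ⟨ha, hma, hb⟩ := hbl_rectangle_geometry p v (y : (EuclideanSpace ℝ (Fin 3))) (hclear y y.2) hηv hs
    have hm : 0 < max ρ (dist (y : (EuclideanSpace ℝ (Fin 3))) p / 2 - L) := hρ.trans_le (le_max_left _ _)
    exact hbl_norm_lineH_le hρ hm ha hma hb

/-- **Real on the real axis.** If the real point `p + σ v` is `ρ`-clear of the `δ`-separated source
`X`, the line sum at `s = σ` equals `⟪e, Σ'_{y ∈ X} (V′(d)/d)(p + σ v − y)⟫`. [folklore] -/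
theorem hbl_lineSum_ofReal {X : Set (EuclideanSpace ℝ (Fin 3))} {δ ρ : ℝ} (hδ : 0 < δ) (hρ : 0 < ρ)
    (hsep : ∀ a ∈ X, ∀ b ∈ X, a ≠ b → δ ≤ dist a b) (p v e : (EuclideanSpace ℝ (Fin 3))) {σ : ℝ}
    (hclear : ∀ y ∈ X, ρ ≤ ‖p + σ • v - y‖) :
    (∑' y : X,
      (((((‖p - y‖ ^ 2 : ℝ) : ℂ) + 2 * (σ : ℂ) * ((⟪p - y, v⟫_ℝ : ℝ) : ℂ) +
            (σ : ℂ) ^ 2 * ((‖v‖ ^ 2 : ℝ) : ℂ)) ^ 4)⁻¹ -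
        ((((‖p - y‖ ^ 2 : ℝ) : ℂ) + 2 * (σ : ℂ) * ((⟪p - y, v⟫_ℝ : ℝ) : ℂ) +
            (σ : ℂ) ^ 2 * ((‖v‖ ^ 2 : ℝ) : ℂ)) ^ 7)⁻¹) *
      (((⟪e, p - y⟫_ℝ : ℝ) : ℂ) + (σ : ℂ) * ((⟪e, v⟫_ℝ : ℝ) : ℂ))) =
      ((⟪e, ∑' y : X, (deriv lennardJones (dist (p + σ • v) y) / dist (p + σ • v) y) •
        (p + σ • v - (y : (EuclideanSpace ℝ (Fin 3))))⟫_ℝ : ℝ) : ℂ) := by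
  have hcl : ∀ y : X, ρ ≤ dist (y : (EuclideanSpace ℝ (Fin 3))) (p + σ • v) := by
    intro y
    rw [dist_comm, dist_eq_norm]
    exact hclear y y.2
  have hsum := (hbl_summable_norm_ljForce_of_clear hδ hρ hsep (fun y : X => (y : (EuclideanSpace ℝ (Fin 3))))
    Subtype.val_injective (fun y => y.2) hcl).of_norm
  have hinner : ⟪e, ∑' y : X, (deriv lennardJones (dist (p + σ • v) y) / dist (p + σ • v) y) •
      (p + σ • v - (y : (EuclideanSpace ℝ (Fin 3))))⟫_ℝ =
      ∑' y : X, ⟪e, (deriv lennardJones (dist (p + σ • v) y) / dist (p + σ • v) y) •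
        (p + σ • v - (y : (EuclideanSpace ℝ (Fin 3))))⟫_ℝ := by
    simpa only [innerSL_apply_apply] using (innerSL ℝ e).map_tsum hsum
  rw [hinner, Complex.ofReal_tsum]
  refine tsum_congr fun y => ?_
  have hne : (y : (EuclideanSpace ℝ (Fin 3))) ≠ p + σ • v := by
    intro h
    have := hcl y
    rw [h, dist_self] at this
    exact (not_le.2 hρ) this
  rw [ljForce_eq_kernel hne, hbl_lineH_ofReal]

/-! ## The identity theorem along a line -/

/-- **Identity theorem along a line.** Let `X⁺, X⁻ ⊂ ℝ³` be `δ`-separated, let the real segment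
`a₁ ≤ σ ≤ a₂` of the line `σ ↦ p + σ v` be `ρ`-clear of both, `η‖v‖ ≤ ρ/2`, and suppose the
component `⟪e, Φ(p + σ v)⟫` of the signed force field vanishes for all `σ` near some
`t₀ ∈ (a₁, a₂)`. Then it vanishes for every `σ ∈ (a₁, a₂)`: the complexified line sum is
holomorphic on the thin rectangle, real with these values on the real axis, and vanishes on a set
accumulating at `t₀`. [folklore] -/
theorem hbl_inner_field_eq_zero_on_line {Xp Xm : Set (EuclideanSpace ℝ (Fin 3))} {δ ρ η : ℝ} (hδ : 0 < δ) (hρ : 0 < ρ)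
    (hη : 0 < η)
    (hsepp : ∀ a ∈ Xp, ∀ b ∈ Xp, a ≠ b → δ ≤ dist a b)
    (hsepm : ∀ a ∈ Xm, ∀ b ∈ Xm, a ≠ b → δ ≤ dist a b) (p v e : (EuclideanSpace ℝ (Fin 3))) {a₁ a₂ : ℝ}
    (hclp : ∀ y ∈ Xp, ∀ σ : ℝ, a₁ ≤ σ → σ ≤ a₂ → ρ ≤ ‖p + σ • v - y‖)
    (hclm : ∀ y ∈ Xm, ∀ σ : ℝ, a₁ ≤ σ → σ ≤ a₂ → ρ ≤ ‖p + σ • v - y‖)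
    (hηv : η * ‖v‖ ≤ ρ / 2) {t₀ : ℝ} (ht₀ : t₀ ∈ Set.Ioo a₁ a₂)
    (hzero : ∀ᶠ σ : ℝ in 𝓝 t₀,
      ⟪e, (∑' y : Xp, (deriv lennardJones (dist (p + σ • v) y) / dist (p + σ • v) y) •
          (p + σ • v - (y : (EuclideanSpace ℝ (Fin 3))))) -
        (∑' y : Xm, (deriv lennardJones (dist (p + σ • v) y) / dist (p + σ • v) y) •
          (p + σ • v - (y : (EuclideanSpace ℝ (Fin 3)))))⟫_ℝ = 0) :
    ∀ σ ∈ Set.Ioo a₁ a₂,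
      ⟪e, (∑' y : Xp, (deriv lennardJones (dist (p + σ • v) y) / dist (p + σ • v) y) •
          (p + σ • v - (y : (EuclideanSpace ℝ (Fin 3))))) -
        (∑' y : Xm, (deriv lennardJones (dist (p + σ • v) y) / dist (p + σ • v) y) •
          (p + σ • v - (y : (EuclideanSpace ℝ (Fin 3)))))⟫_ℝ = 0 := by
  set U : Set ℂ := Complex.re ⁻¹' Set.Ioo a₁ a₂ ∩ Complex.im ⁻¹' Set.Ioo (-η) η with hUdef
  have hUo : IsOpen U :=
    (isOpen_Ioo.preimage Complex.continuous_re).inter (isOpen_Ioo.preimage Complex.continuous_im)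
  have hUc : IsPreconnected U := by
    refine (Convex.inter ?_ ?_).isPreconnected
    · have h := (convex_Ioo a₁ a₂).linear_preimage Complex.reLm
      rwa [Complex.reLm_coe] at h
    · have h := (convex_Ioo (-η) η).linear_preimage Complex.imLm
      rwa [Complex.imLm_coe] at h
  -- the complexified line sums
  set Gp : ℂ → ℂ := fun s : ℂ => ∑' y : Xp,
      (((((‖p - y‖ ^ 2 : ℝ) : ℂ) + 2 * s * ((⟪p - y, v⟫_ℝ : ℝ) : ℂ) + s ^ 2 * ((‖v‖ ^ 2 : ℝ) : ℂ)) ^ 4)⁻¹ -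
        ((((‖p - y‖ ^ 2 : ℝ) : ℂ) + 2 * s * ((⟪p - y, v⟫_ℝ : ℝ) : ℂ) + s ^ 2 * ((‖v‖ ^ 2 : ℝ) : ℂ)) ^ 7)⁻¹) *
      (((⟪e, p - y⟫_ℝ : ℝ) : ℂ) + s * ((⟪e, v⟫_ℝ : ℝ) : ℂ)) with hGp
  set Gm : ℂ → ℂ := fun s : ℂ => ∑' y : Xm,
      (((((‖p - y‖ ^ 2 : ℝ) : ℂ) + 2 * s * ((⟪p - y, v⟫_ℝ : ℝ) : ℂ) + s ^ 2 * ((‖v‖ ^ 2 : ℝ) : ℂ)) ^ 4)⁻¹ -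
        ((((‖p - y‖ ^ 2 : ℝ) : ℂ) + 2 * s * ((⟪p - y, v⟫_ℝ : ℝ) : ℂ) + s ^ 2 * ((‖v‖ ^ 2 : ℝ) : ℂ)) ^ 7)⁻¹) *
      (((⟪e, p - y⟫_ℝ : ℝ) : ℂ) + s * ((⟪e, v⟫_ℝ : ℝ) : ℂ)) with hGm
  have hGan : AnalyticOnNhd ℂ (fun s => Gp s - Gm s) U :=
    ((hbl_differentiableOn_lineSum hδ hρ hsepp p v e hclp hηv).sub
      (hbl_differentiableOn_lineSum hδ hρ hsepm p v e hclm hηv)).analyticOnNhd hUo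
  -- values on the real axis
  have hreal : ∀ σ : ℝ, σ ∈ Set.Ioo a₁ a₂ → Gp σ - Gm σ =
      ((⟪e, (∑' y : Xp, (deriv lennardJones (dist (p + σ • v) y) / dist (p + σ • v) y) •
          (p + σ • v - (y : (EuclideanSpace ℝ (Fin 3))))) -
        (∑' y : Xm, (deriv lennardJones (dist (p + σ • v) y) / dist (p + σ • v) y) •
          (p + σ • v - (y : (EuclideanSpace ℝ (Fin 3)))))⟫_ℝ : ℝ) : ℂ) := by
    intro σ hσ
    simp only [hGp, hGm]
    rw [inner_sub_right, Complex.ofReal_sub,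
      hbl_lineSum_ofReal hδ hρ hsepp p v e (fun y hy => hclp y hy σ hσ.1.le hσ.2.le),
      hbl_lineSum_ofReal hδ hρ hsepm p v e (fun y hy => hclm y hy σ hσ.1.le hσ.2.le)]
  have hmemU : ∀ σ : ℝ, σ ∈ Set.Ioo a₁ a₂ → (σ : ℂ) ∈ U := by
    intro σ hσ
    refine ⟨?_, ?_⟩
    · show (σ : ℂ).re ∈ Set.Ioo a₁ a₂
      rwa [Complex.ofReal_re]
    · show (σ : ℂ).im ∈ Set.Ioo (-η) η
      rw [Complex.ofReal_im]
      exact ⟨by linarith, hη⟩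
  -- zeros accumulating at `t₀`
  have hfreq : ∃ᶠ z in 𝓝[≠] ((t₀ : ℝ) : ℂ), Gp z - Gm z = 0 := by
    rw [Filter.frequently_iff]
    intro W hW
    obtain ⟨ε', hε', hW'⟩ := Metric.mem_nhdsWithin_iff.1 hW
    obtain ⟨ε, hε, hball⟩ := Metric.eventually_nhds_iff.1 hzero
    set κ : ℝ := min (min ε ε') (a₂ - t₀) / 2 with hκ
    have hm0 : 0 < min (min ε ε') (a₂ - t₀) := lt_min (lt_min hε hε') (by linarith [ht₀.2])
    have hκ0 : 0 < κ := by rw [hκ]; linarith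
    have hκlt : κ < min (min ε ε') (a₂ - t₀) := by rw [hκ]; linarith
    have hκε : κ < ε := hκlt.trans_le ((min_le_left _ _).trans (min_le_left _ _))
    have hκε' : κ < ε' := hκlt.trans_le ((min_le_left _ _).trans (min_le_right _ _))
    have hκa : t₀ + κ < a₂ := by linarith [hκlt.trans_le (min_le_right _ _)]
    have hmem : t₀ + κ ∈ Set.Ioo a₁ a₂ := ⟨by linarith [ht₀.1], hκa⟩
    have hdist : dist (((t₀ + κ : ℝ)) : ℂ) ((t₀ : ℝ) : ℂ) = κ := by
      rw [Complex.dist_eq, ← Complex.ofReal_sub, Complex.norm_real, Real.norm_eq_abs,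
        add_sub_cancel_left, abs_of_pos hκ0]
    refine ⟨((t₀ + κ : ℝ) : ℂ), hW' ⟨?_, ?_⟩, ?_⟩
    · rw [Metric.mem_ball, hdist]
      exact hκε'
    · rw [Set.mem_compl_iff, Set.mem_singleton_iff, Complex.ofReal_inj]
      linarith
    · rw [hreal _ hmem, Complex.ofReal_eq_zero]
      apply hball
      rw [Real.dist_eq, add_sub_cancel_left, abs_of_pos hκ0]
      exact hκε
  have hzeroU := hGan.eqOn_zero_of_preconnected_of_frequently_eq_zero hUc (hmemU t₀ ht₀) hfreq
  intro σ hσ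
  have h := hzeroU (hmemU σ hσ)
  simp only [Pi.zero_apply] at h
  rwa [hreal σ hσ, Complex.ofReal_eq_zero] at h


/-! ## From an open zero set along clean segments -/

/-- **Propagation along clean segments.** Let `X⁺, X⁻ ⊂ ℝ³` be `δ`-separated and let the signed
force field `Φ = Σ'_{X⁺} (V′/d)(· − y) − Σ'_{X⁻} (V′/d)(· − y)` vanish on an open set `U₀ ∋ x₀`.
If the closed segment `[x₀, x]` misses `X⁺ ∪ X⁻`, then `Φ(x) = 0`: the segment is uniformly clear
of the (closed) source by compactness, so `hbl_inner_field_eq_zero_on_line` applies on a slightly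
longer parameter interval, for every test vector `e`. [folklore] -/
theorem hbl_field_eq_zero_of_clean_segment {Xp Xm : Set (EuclideanSpace ℝ (Fin 3))} {δ : ℝ}
    (hδ : 0 < δ)
    (hsepp : ∀ a ∈ Xp, ∀ b ∈ Xp, a ≠ b → δ ≤ dist a b)
    (hsepm : ∀ a ∈ Xm, ∀ b ∈ Xm, a ≠ b → δ ≤ dist a b)
    {U₀ : Set (EuclideanSpace ℝ (Fin 3))} (hU₀ : IsOpen U₀)
    (hΦ : ∀ z ∈ U₀,
      (∑' y : Xp, (deriv lennardJones (dist z y) / dist z y) • (z - (y : (EuclideanSpace ℝ (Fin 3))))) -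
        (∑' y : Xm, (deriv lennardJones (dist z y) / dist z y) • (z - (y : (EuclideanSpace ℝ (Fin 3))))) = 0)
    {x₀ x : EuclideanSpace ℝ (Fin 3)} (hx₀ : x₀ ∈ U₀)
    (hseg : ∀ σ : ℝ, 0 ≤ σ → σ ≤ 1 → x₀ + σ • (x - x₀) ∉ Xp ∪ Xm) :
    (∑' y : Xp, (deriv lennardJones (dist x y) / dist x y) • (x - (y : (EuclideanSpace ℝ (Fin 3))))) -
      (∑' y : Xm, (deriv lennardJones (dist x y) / dist x y) • (x - (y : (EuclideanSpace ℝ (Fin 3))))) = 0 := by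
  set v : EuclideanSpace ℝ (Fin 3) := x - x₀ with hv
  -- the source is closed
  have hXc : IsClosed (Xp ∪ Xm) :=
    (Metric.isClosed_of_pairwise_le_dist hδ hsepp).union (Metric.isClosed_of_pairwise_le_dist hδ hsepm)
  -- uniform clearance of the compact segment
  obtain ⟨ρ₀, hρ₀, hclear0⟩ : ∃ ρ₀ : ℝ, 0 < ρ₀ ∧ ∀ σ ∈ Set.Icc (0 : ℝ) 1, ∀ y ∈ Xp ∪ Xm,
      ρ₀ ≤ ‖x₀ + σ • v - y‖ := by
    rcases (Xp ∪ Xm).eq_empty_or_nonempty with hempty | hne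
    · refine ⟨1, one_pos, fun σ _ y hy => ?_⟩
      rw [hempty] at hy
      exact absurd hy (Set.notMem_empty _)
    · have hγ : Continuous fun σ : ℝ => x₀ + σ • v := by fun_prop
      have hcont : Continuous fun σ : ℝ => Metric.infDist (x₀ + σ • v) (Xp ∪ Xm) :=
        (Metric.continuous_infDist_pt (s := Xp ∪ Xm)).comp hγ
      have hpos : ∀ σ ∈ Set.Icc (0 : ℝ) 1, 0 < Metric.infDist (x₀ + σ • v) (Xp ∪ Xm) :=
        fun σ hσ => (hXc.notMem_iff_infDist_pos hne).1 (hseg σ hσ.1 hσ.2)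
      obtain ⟨ρ₀, hρ₀, hle⟩ := isCompact_Icc.exists_forall_le' hcont.continuousOn hpos
      refine ⟨ρ₀, hρ₀, fun σ hσ y hy => (hle σ hσ).trans ?_⟩
      rw [← dist_eq_norm]
      exact Metric.infDist_le_dist_of_mem hy
  -- width of the rectangle
  set η : ℝ := ρ₀ / (4 * (‖v‖ + 1)) with hη
  have hv1 : 0 < ‖v‖ + 1 := by positivity
  have hη0 : 0 < η := by positivity
  have hηv : η * ‖v‖ ≤ ρ₀ / 4 := by
    rw [hη, div_mul_eq_mul_div, div_le_div_iff₀ (by positivity) (by norm_num : (0 : ℝ) < 4)]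
    nlinarith [norm_nonneg v]
  -- clearance `ρ₀/2` on the extended parameter interval `[-η, 1 + η]`
  have hclear : ∀ y ∈ Xp ∪ Xm, ∀ σ : ℝ, -η ≤ σ → σ ≤ 1 + η → ρ₀ / 2 ≤ ‖x₀ + σ • v - y‖ := by
    intro y hy σ h1 h2
    set σ' : ℝ := max 0 (min σ 1) with hσ'
    have hσ'mem : σ' ∈ Set.Icc (0 : ℝ) 1 :=
      ⟨le_max_left _ _, max_le zero_le_one (min_le_right _ _)⟩
    have hdiff : |σ - σ'| ≤ η := by
      rw [hσ']
      rcases le_total σ 1 with hσ1 | hσ1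
      · rw [min_eq_left hσ1]
        rcases le_total 0 σ with hσ0 | hσ0
        · rw [max_eq_right hσ0, sub_self, abs_zero]
          exact hη0.le
        · rw [max_eq_left hσ0, sub_zero, abs_of_nonpos hσ0]
          linarith
      · rw [min_eq_right hσ1, max_eq_right zero_le_one, abs_of_nonneg (by linarith)]
        linarith
    have h0 := hclear0 σ' hσ'mem y hy
    have hsplit : x₀ + σ' • v - y = (x₀ + σ • v - y) + (σ' - σ) • v := by
      rw [sub_smul]
      abel
    have htri : ‖x₀ + σ' • v - y‖ ≤ ‖x₀ + σ • v - y‖ + ‖(σ' - σ) • v‖ := by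
      rw [hsplit]
      exact norm_add_le _ _
    have hsm : ‖(σ' - σ) • v‖ ≤ ρ₀ / 4 := by
      rw [norm_smul, Real.norm_eq_abs, abs_sub_comm]
      calc |σ - σ'| * ‖v‖ ≤ η * ‖v‖ := mul_le_mul_of_nonneg_right hdiff (norm_nonneg _)
        _ ≤ ρ₀ / 4 := hηv
    linarith
  -- the field vanishes near `σ = 0` along the line
  have hev : ∀ᶠ σ : ℝ in 𝓝 (0 : ℝ), x₀ + σ • v ∈ U₀ := by
    have hc : Continuous fun σ : ℝ => x₀ + σ • v := by fun_prop
    have h0 : x₀ + (0 : ℝ) • v ∈ U₀ := by simpa using hx₀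
    exact hc.continuousAt.eventually_mem (hU₀.mem_nhds h0)
  -- every component of `Φ(x)` vanishes
  have hmain : ∀ e : EuclideanSpace ℝ (Fin 3),
      ⟪e, (∑' y : Xp, (deriv lennardJones (dist x y) / dist x y) • (x - (y : (EuclideanSpace ℝ (Fin 3))))) -
        (∑' y : Xm, (deriv lennardJones (dist x y) / dist x y) •
          (x - (y : (EuclideanSpace ℝ (Fin 3)))))⟫_ℝ = 0 := by
    intro e
    have h := hbl_inner_field_eq_zero_on_line (Xp := Xp) (Xm := Xm) hδ (half_pos hρ₀) hη0 hsepp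
      hsepm x₀ v e (a₁ := -η) (a₂ := 1 + η)
      (fun y hy σ h1 h2 => hclear y (Or.inl hy) σ h1 h2)
      (fun y hy σ h1 h2 => hclear y (Or.inr hy) σ h1 h2)
      (by linarith : η * ‖v‖ ≤ ρ₀ / 2 / 2) (t₀ := 0) ⟨by linarith, by linarith⟩ ?_ 1
      ⟨by linarith, by linarith⟩
    · have hx1 : x₀ + (1 : ℝ) • v = x := by
        rw [one_smul, hv, add_sub_cancel]
      rwa [hx1] at h
    · filter_upwards [hev] with σ hσ
      rw [hΦ _ hσ, inner_zero_right]
  exact inner_self_eq_zero.1 (hmain _)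

end Summit.AtomisticToContinuum.Crystallization.Theorems

end
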